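import Literature.Probability.LatticeModels.ProdBernoulliIndependence
import Literature.Probability.Percolation.PercolationEvents
import HarnessLib

/-!
# `NoHeavyLowerTail` (stmt-CriticalPhenomena-4575) — support file: the two HARRIS constraints of the parallel step
# (prover `prim-ineq-prove-2` gen 11, MEMO-20 §2)

No definitions, no named facts, no sorries.  Companion of `PercNearOneGluingNoHeavyLowerTailGZParallel.lean`: there the
parallel step of the logarithmic covariance bound is proved for abstract six-cell laws under the hypotheses
`(H3) P(a|b|c) ≥ P(a ↮ c)·P(b ↮ a, b ↮ c)` and `(H4) P(a|b|c) ≥ P(b ↮ c)·P(a ↮ b, a ↮ c)`.  Here we record that every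
finite weighted graph satisfies them: both are Harris' inequality (tree theorem `prodBernoulli_harris_lower`) for two
DEcreasing events, `{a ↮ c}` and `{b ↮ a} ∩ {b ↮ c}`, whose intersection is `{a, b, c pairwise disconnected}`.

* `GZParallel.real_notConn_mul_isolated_le` — `P(a ↮ c)·P(b ↮ a ∧ b ↮ c) ≤ P(a|b|c)`;
* `GZParallel.real_notConn_mul_isolated_le'` — the mirror image `P(b ↮ c)·P(a ↮ b ∧ a ↮ c) ≤ P(a|b|c)`.
-/

noncomputable section

namespace Summit.CriticalPhenomena.PercolationContinuityZ3.Theorems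

open MeasureTheory Literature.Probability.LatticeModels Literature.Probability.Percolation
open scoped Classical

namespace GZParallel

variable {V : Type*} [Fintype V]

/-- **(H3)** `P(a ↮ c) · P(b ↮ a ∧ b ↮ c) ≤ P(a ↮ b ∧ a ↮ c ∧ b ↮ c)` on every finite weighted graph: Harris' inequality
for the decreasing events `{a ↮ c}` and `{b ↮ a} ∩ {b ↮ c}` (Harris 1960; Grimmett 1999 Thm (2.4)). [folklore] -/
theorem real_notConn_mul_isolated_le (w : Sym2 V → unitInterval) (a b c : V) :
    (prodBernoulli w).real (openConn a c : Set (BondConfig V))ᶜ *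
        (prodBernoulli w).real ((openConn b a : Set (BondConfig V))ᶜ ∩ (openConn b c : Set (BondConfig V))ᶜ) ≤
      (prodBernoulli w).real
        ((openConn a c : Set (BondConfig V))ᶜ ∩ ((openConn b a : Set (BondConfig V))ᶜ ∩ (openConn b c : Set (BondConfig V))ᶜ)) := by
  have hA : IsLowerSet (openConn a c : Set (BondConfig V))ᶜ := (isUpperSet_openConn a c).compl
  have hB : IsLowerSet ((openConn b a : Set (BondConfig V))ᶜ ∩ (openConn b c : Set (BondConfig V))ᶜ) :=
    (isUpperSet_openConn b a).compl.inter (isUpperSet_openConn b c).compl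
  exact prodBernoulli_harris_lower w hA hB MeasurableSet.of_discrete MeasurableSet.of_discrete

/-- **(H4)** `P(b ↮ c) · P(a ↮ b ∧ a ↮ c) ≤ P(b ↮ c ∧ a ↮ b ∧ a ↮ c)`: the mirror image of
`real_notConn_mul_isolated_le`. [folklore] -/
theorem real_notConn_mul_isolated_le' (w : Sym2 V → unitInterval) (a b c : V) :
    (prodBernoulli w).real (openConn b c : Set (BondConfig V))ᶜ *
        (prodBernoulli w).real ((openConn a b : Set (BondConfig V))ᶜ ∩ (openConn a c : Set (BondConfig V))ᶜ) ≤
      (prodBernoulli w).real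
        ((openConn b c : Set (BondConfig V))ᶜ ∩ ((openConn a b : Set (BondConfig V))ᶜ ∩ (openConn a c : Set (BondConfig V))ᶜ)) :=
  real_notConn_mul_isolated_le w b a c

end GZParallel

end Summit.CriticalPhenomena.PercolationContinuityZ3.Theorems
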